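import Summits.HubbardSuperconductivity.HubbardSuperconductivity.Theses.ColourTheSpin
import Literature.MathematicalPhysics.QuantumLattice.PairFieldEvenSideLRO
import HarnessLib

/-!
# `ColourTheSpin.SgEndpoint` (stmt-HubbardSuperconductivity-16272) — strategist SPLIT GLUE
# `SgPenaltyUpgrade → SgTwistGap → SgPenalisedEndpoint → SgEndpoint`

Crux-strategist decomposition (Cruxes/SgEndpoint/STRATEGY-CENSUS.md, 2026-08-17) of the rank-2 crux
`SgEndpoint` ("corridor order of the `Q₈`-spin-gauged torus, uniform in `g ∈ (0,g₀]` ⇒ the summit's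
matrix at `(U,δ)`") into three typed pieces, with the implication PROVED here (logic + the landed
even-side LRO bookkeeping `hasLongRangeOrder_even_of_le` / `sum_pairFieldCorr_succ`):

* `SgPenaltyUpgrade` (crux, open; the kind-(B) residue on the GAUGED side): every-ground-state order of
  the `N_L`-block of `H_g` for `g ∈ (0,g₀]` ⇒ every-ground-state order of the PENALISED block
  `H_g + (κ/L⁴)(Δ_d^g)†Δ_d^g` for some `κ > 0` (equivalently the `κ`-chord `E₀(H_g+κY) − E₀(H_g) ≥ κc₁`,
  `Y = L⁻⁴(Δ_d^g)†Δ_d^g`, by the Kaplan–Horsch–von der Linden sandwich);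
* `SgTwistGap` (crux, open, mild): the `N_L`-block ground energy of the periodic Hubbard torus exceeds
  no flat-`Q₈`-twisted frozen-link energy by more than `o(1)` (vanishing twist gap);
* `SgPenalisedEndpoint` (support, PROVABLE NOW, finite-dimensional): penalised corridor order + twist
  gap `≤ κc₁/2` ⇒ every `(N_L, S^z=0)`-sector ground state of `hubbardTorus 2 L 1 U` has
  `Re⟨Δ_d†Δ_d⟩ ≥ aL⁴` cofinitely in even `L`. Mechanism: ground-state ENERGIES pass to the `g → 0⁺`
  limit with no selection (`e(κ) ≤ E₀^N(H_g+κY) ≤ e(κ) + (7/8)g²|Bond L|`, `e(κ) = min_{k flat}` of the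
  frozen `N`-block ground energy of `H_F(k) + κY_k`), the sandwich turns penalised brightness into the
  chord `e(κ) − e(0) ≥ κc₁`, and the chord prices EVERY ground state of the trivial flat class
  (`κ⟨Y_1⟩_φ ≥ e(κ) − e₀(1) ≥ κc₁ − twist gap`) — both bets of the birth line (strict zero-twist
  SELECTION, some ⇒ every homogeneity) disappear; what remains is child 1 (deletable at route level by
  re-typing the corridor target penalised) and child 2.

The three children are stated as CLOSED Props whose texts are exactly the `statement` fields filed with
`ledger route edit … --split SgEndpoint` (self-contained over the route file's imports: the gauged
objects are inlined as in the parent item), and the glue `sgEndpoint_of_subs` concludes the crux BY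
NAME. The parametrised vocabulary (`CorridorOrderAt`, `PenalisedCorridorAt`, `TwistGapSmallAt`,
`EveryGroundStateOrderAt`, `SectorLROAt`) is definitionally the same text (`*_iff : … := Iff.rfl`).
No statement about the Hubbard model is proved here (all three hypotheses are open items or provable
work); nothing is vendored. [cite: KaplanHorschVonDerLinden1989 (doi:10.1143/jpsj.58.3894),
the two-line variational sandwich] [cite: doi:10.1103/physrevd.11.395 (Kogut–Susskind weak-coupling/flat limit)]
-/

noncomputable section

set_option linter.dupNamespace false
set_option linter.style.longLine false

namespace Summit.HubbardSuperconductivity.HubbardSuperconductivity.Theorems.ColourTheSpin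

section Verbatim

-- exactly the `open`s of the route file `Theses/ColourTheSpin.lean`, so that the texts below elaborate
-- to the same terms as the route items (cf. `Cruxes/SgEndpoint/Lines/birth.lean`, `sgEndpoint_iff`)
open scoped BigOperators Topology Manifold Classical MeasureTheory ProbabilityTheory Matrix InnerProductSpace ComplexConjugate ContinuousMap
open Filter Set Function TopologicalSpace MeasureTheory
open Literature.Hubbard

/-- **Child 1 — `SgPenaltyUpgrade`** (crux; text = the `statement` filed for the route item). [folklore] -/
def SgPenaltyUpgrade : Prop :=
  open Literature.MathematicalPhysics.QuantumLattice in ∀ (U δ g₀ c' : ℝ) (L₁ : ℕ), 0 < U → δ ∈ Set.Ioo (0 : ℝ) (1 / 2) → 0 < g₀ → 0 < c' → (∀ g : ℝ, 0 < g → g ≤ g₀ → ∀ (L : ℕ) [NeZero L], L₁ ≤ L → Even L → (let m : Fin 2 × ZMod 4 → Fin 2 × ZMod 4 → Fin 2 × ZMod 4 := fun u v => (u.1 + v.1, if u.1 = 0 then (if v.1 = 0 then u.2 + v.2 else v.2 - u.2) else if v.1 = 0 then u.2 + v.2 else 2 + v.2 - u.2); let iv : Fin 2 × ZMod 4 → Fin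 2 × ZMod 4 := fun u => (u.1, if u.1 = 0 then -u.2 else u.2 + 2); let r : Fin 2 × ZMod 4 → Fin 2 → Fin 2 → ℂ := fun u σ τ => if u.1 = 0 then (if σ = τ then (if σ = 0 then Complex.I else -Complex.I) ^ u.2.val else 0) else if σ = τ then 0 else if σ = 0 then -(-Complex.I) ^ u.2.val else Complex.I ^ u.2.val; let hop := ∑ b : GaugedHubbard.Bond L, ∑ σ : Fin 2, ∑ τ : Fin 2, Matrix.kroneckerMap (· * ·) (creation (orb b.1 σ) * annihilation (orb (b.1.shift b.2) τ)) (Matrix.diagonal fun k : GaugedHubbard.Bond L → Fin 2 × ZMod 4 => r (k b) σ τ); let H := -(hop + hopᴴ) + ((U : ℝ) : ℂ) • Matrix.kroneckerMap (· * ·) (∑ x : FermionTorus 2 L, numberOp x 0 * numberOp x 1) (1 : Matrix (GaugedHubbard.Bond L → Fin 2 × ZMod 4) (GaugedHubbard.Bond L → Fin 2 × ZMod 4) ℂ) + ((g ^ 2 : ℝ) : ℂ) • Matrix.kroneckerMap (· * ·) (1 : Matrix (Finset (Orb (FermionTorus 2 L))) _ ℂ) (∑ b : GaugedHubbard.Bond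 L, Matrix.of fun k k' : GaugedHubbard.Bond L → Fin 2 × ZMod 4 => if k' = Function.update k b (k' b) then (if k b = k' b then (1 : ℂ) else 0) - 1 / 8 else 0) + ((1 / g ^ 2 : ℝ) : ℂ) • Matrix.kroneckerMap (· * ·) (1 : Matrix (Finset (Orb (FermionTorus 2 L))) _ ℂ) (Matrix.diagonal fun k : GaugedHubbard.Bond L → Fin 2 × ZMod 4 => ∑ x : FermionTorus 2 L, (1 - (r (m (m (m (k (x, 0)) (k (x.shift 0, 1))) (iv (k (x.shift 1, 0)))) (iv (k (x, 1)))) 0 0 + r (m (m (m (k (x, 0)) (k (x.shift 0, 1))) (iv (k (x.shift 1, 0)))) (iv (k (x, 1)))) 1 1) / 2)); let P := ∑ b : GaugedHubbard.Bond L, (if b.2 = 0 then (1 : ℂ) else -1) • ∑ σ : Fin 2, ∑ τ : Fin 2, Matrix.kroneckerMap (· * ·) (annihilation (orb b.1 σ) * annihilation (orb (b.1.shift b.2) τ)) (Matrix.diagonal fun k : GaugedHubbard.Bond L → Fin 2 × ZMod 4 => if σ = 0 then r (k b) 1 τ else -r (k b) 0 τ); let p := fun ik : Finset (Orb (FermionTorus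 2 L)) × (GaugedHubbard.Bond L → Fin 2 × ZMod 4) => ik.1.card = 2 * ⌊(1 - δ) * (L : ℝ) ^ 2 / 2⌋₊; ∀ ψ : {ik // p ik} → ℂ, (ψ ≠ 0 ∧ ∃ E : ℝ, H.toBlock p p *ᵥ ψ = (E : ℂ) • ψ ∧ ∀ φ : {ik // p ik} → ℂ, E * (star φ ⬝ᵥ φ).re ≤ (star φ ⬝ᵥ H.toBlock p p *ᵥ φ).re) → c' * (L : ℝ) ^ 4 * (star ψ ⬝ᵥ ψ).re ≤ (star ψ ⬝ᵥ (Pᴴ * P).toBlock p p *ᵥ ψ).re)) → ∃ g₁ : ℝ, 0 < g₁ ∧ ∃ c₁ : ℝ, 0 < c₁ ∧ ∃ κ : ℝ, 0 < κ ∧ ∃ L₂ : ℕ, (∀ g : ℝ, 0 < g → g ≤ g₁ → ∀ (L : ℕ) [NeZero L], L₂ ≤ L → Even L → (let m : Fin 2 × ZMod 4 → Fin 2 × ZMod 4 → Fin 2 × ZMod 4 := fun u v => (u.1 + v.1, if u.1 = 0 then (if v.1 = 0 then u.2 + v.2 else v.2 - u.2) else if v.1 = 0 then u.2 + v.2 else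 2 + v.2 - u.2); let iv : Fin 2 × ZMod 4 → Fin 2 × ZMod 4 := fun u => (u.1, if u.1 = 0 then -u.2 else u.2 + 2); let r : Fin 2 × ZMod 4 → Fin 2 → Fin 2 → ℂ := fun u σ τ => if u.1 = 0 then (if σ = τ then (if σ = 0 then Complex.I else -Complex.I) ^ u.2.val else 0) else if σ = τ then 0 else if σ = 0 then -(-Complex.I) ^ u.2.val else Complex.I ^ u.2.val; let hop := ∑ b : GaugedHubbard.Bond L, ∑ σ : Fin 2, ∑ τ : Fin 2, Matrix.kroneckerMap (· * ·) (creation (orb b.1 σ) * annihilation (orb (b.1.shift b.2) τ)) (Matrix.diagonal fun k : GaugedHubbard.Bond L → Fin 2 × ZMod 4 => r (k b) σ τ); let H := -(hop + hopᴴ) + ((U : ℝ) : ℂ) • Matrix.kroneckerMap (· * ·) (∑ x : FermionTorus 2 L, numberOp x 0 * numberOp x 1) (1 : Matrix (GaugedHubbard.Bond L → Fin 2 × ZMod 4) (GaugedHubbard.Bond L → Fin 2 × ZMod 4) ℂ) + ((g ^ 2 : ℝ) : ℂ) • Matrix.kroneckerMap (· * ·) (1 : Matrix (Finset (Orb (FermionTorus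 2 L))) _ ℂ) (∑ b : GaugedHubbard.Bond L, Matrix.of fun k k' : GaugedHubbard.Bond L → Fin 2 × ZMod 4 => if k' = Function.update k b (k' b) then (if k b = k' b then (1 : ℂ) else 0) - 1 / 8 else 0) + ((1 / g ^ 2 : ℝ) : ℂ) • Matrix.kroneckerMap (· * ·) (1 : Matrix (Finset (Orb (FermionTorus 2 L))) _ ℂ) (Matrix.diagonal fun k : GaugedHubbard.Bond L → Fin 2 × ZMod 4 => ∑ x : FermionTorus 2 L, (1 - (r (m (m (m (k (x, 0)) (k (x.shift 0, 1))) (iv (k (x.shift 1, 0)))) (iv (k (x, 1)))) 0 0 + r (m (m (m (k (x, 0)) (k (x.shift 0, 1))) (iv (k (x.shift 1, 0)))) (iv (k (x, 1)))) 1 1) / 2)); let P := ∑ b : GaugedHubbard.Bond L, (if b.2 = 0 then (1 : ℂ) else -1) • ∑ σ : Fin 2, ∑ τ : Fin 2, Matrix.kroneckerMap (· * ·) (annihilation (orb b.1 σ) * annihilation (orb (b.1.shift b.2) τ)) (Matrix.diagonal fun k : GaugedHubbard.Bond L → Fin 2 × ZMod 4 => if σ = 0 then r (k b) 1 τ else -r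 (k b) 0 τ); let Hκ := H + ((κ / (L : ℝ) ^ 4 : ℝ) : ℂ) • (Pᴴ * P); let p := fun ik : Finset (Orb (FermionTorus 2 L)) × (GaugedHubbard.Bond L → Fin 2 × ZMod 4) => ik.1.card = 2 * ⌊(1 - δ) * (L : ℝ) ^ 2 / 2⌋₊; ∀ ψ : {ik // p ik} → ℂ, (ψ ≠ 0 ∧ ∃ E : ℝ, Hκ.toBlock p p *ᵥ ψ = (E : ℂ) • ψ ∧ ∀ φ : {ik // p ik} → ℂ, E * (star φ ⬝ᵥ φ).re ≤ (star φ ⬝ᵥ Hκ.toBlock p p *ᵥ φ).re) → c₁ * (L : ℝ) ^ 4 * (star ψ ⬝ᵥ ψ).re ≤ (star ψ ⬝ᵥ (Pᴴ * P).toBlock p p *ᵥ ψ).re))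

/-- **Child 2 — `SgTwistGap`** (crux; text = the `statement` filed for the route item). [folklore] -/
def SgTwistGap : Prop :=
  open Literature.MathematicalPhysics.QuantumLattice in ∀ (U δ g₀ c' : ℝ) (L₁ : ℕ), 0 < U → δ ∈ Set.Ioo (0 : ℝ) (1 / 2) → 0 < g₀ → 0 < c' → (∀ g : ℝ, 0 < g → g ≤ g₀ → ∀ (L : ℕ) [NeZero L], L₁ ≤ L → Even L → (let m : Fin 2 × ZMod 4 → Fin 2 × ZMod 4 → Fin 2 × ZMod 4 := fun u v => (u.1 + v.1, if u.1 = 0 then (if v.1 = 0 then u.2 + v.2 else v.2 - u.2) else if v.1 = 0 then u.2 + v.2 else 2 + v.2 - u.2); let iv : Fin 2 × ZMod 4 → Fin 2 × ZMod 4 := fun u => (u.1, if u.1 = 0 then -u.2 else u.2 + 2); let r : Fin 2 × ZMod 4 → Fin 2 → Fin 2 → ℂ := fun u σ τ => if u.1 = 0 then (if σ = τ then (if σ = 0 then Complex.I else -Complex.I) ^ u.2.val else 0) else if σ = τ then 0 else if σ = 0 then -(-Complex.I) ^ u.2.val else Complex.I ^ u.2.val; let hop := ∑ b : GaugedHubbard.Bond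 L, ∑ σ : Fin 2, ∑ τ : Fin 2, Matrix.kroneckerMap (· * ·) (creation (orb b.1 σ) * annihilation (orb (b.1.shift b.2) τ)) (Matrix.diagonal fun k : GaugedHubbard.Bond L → Fin 2 × ZMod 4 => r (k b) σ τ); let H := -(hop + hopᴴ) + ((U : ℝ) : ℂ) • Matrix.kroneckerMap (· * ·) (∑ x : FermionTorus 2 L, numberOp x 0 * numberOp x 1) (1 : Matrix (GaugedHubbard.Bond L → Fin 2 × ZMod 4) (GaugedHubbard.Bond L → Fin 2 × ZMod 4) ℂ) + ((g ^ 2 : ℝ) : ℂ) • Matrix.kroneckerMap (· * ·) (1 : Matrix (Finset (Orb (FermionTorus 2 L))) _ ℂ) (∑ b : GaugedHubbard.Bond L, Matrix.of fun k k' : GaugedHubbard.Bond L → Fin 2 × ZMod 4 => if k' = Function.update k b (k' b) then (if k b = k' b then (1 : ℂ) else 0) - 1 / 8 else 0) + ((1 / g ^ 2 : ℝ) : ℂ) • Matrix.kroneckerMap (· * ·) (1 : Matrix (Finset (Orb (FermionTorus 2 L))) _ ℂ) (Matrix.diagonal fun k : GaugedHubbard.Bond L → Fin 2 × ZMod 4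 => ∑ x : FermionTorus 2 L, (1 - (r (m (m (m (k (x, 0)) (k (x.shift 0, 1))) (iv (k (x.shift 1, 0)))) (iv (k (x, 1)))) 0 0 + r (m (m (m (k (x, 0)) (k (x.shift 0, 1))) (iv (k (x.shift 1, 0)))) (iv (k (x, 1)))) 1 1) / 2)); let P := ∑ b : GaugedHubbard.Bond L, (if b.2 = 0 then (1 : ℂ) else -1) • ∑ σ : Fin 2, ∑ τ : Fin 2, Matrix.kroneckerMap (· * ·) (annihilation (orb b.1 σ) * annihilation (orb (b.1.shift b.2) τ)) (Matrix.diagonal fun k : GaugedHubbard.Bond L → Fin 2 × ZMod 4 => if σ = 0 then r (k b) 1 τ else -r (k b) 0 τ); let p := fun ik : Finset (Orb (FermionTorus 2 L)) × (GaugedHubbard.Bond L → Fin 2 × ZMod 4) => ik.1.card = 2 * ⌊(1 - δ) * (L : ℝ) ^ 2 / 2⌋₊; ∀ ψ : {ik // p ik} → ℂ, (ψ ≠ 0 ∧ ∃ E : ℝ, H.toBlock p p *ᵥ ψ = (E : ℂ) • ψ ∧ ∀ φ : {ik // p ik} → ℂ, E * (star φ ⬝ᵥ φ).re ≤ (star φ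 ⬝ᵥ H.toBlock p p *ᵥ φ).re) → c' * (L : ℝ) ^ 4 * (star ψ ⬝ᵥ ψ).re ≤ (star ψ ⬝ᵥ (Pᴴ * P).toBlock p p *ᵥ ψ).re)) → ∀ ε : ℝ, 0 < ε → ∃ L₃ : ℕ, (∀ (L : ℕ) [NeZero L], L₃ ≤ L → Even L → (let m : Fin 2 × ZMod 4 → Fin 2 × ZMod 4 → Fin 2 × ZMod 4 := fun u v => (u.1 + v.1, if u.1 = 0 then (if v.1 = 0 then u.2 + v.2 else v.2 - u.2) else if v.1 = 0 then u.2 + v.2 else 2 + v.2 - u.2); let iv : Fin 2 × ZMod 4 → Fin 2 × ZMod 4 := fun u => (u.1, if u.1 = 0 then -u.2 else u.2 + 2); let r : Fin 2 × ZMod 4 → Fin 2 → Fin 2 → ℂ := fun u σ τ => if u.1 = 0 then (if σ = τ then (if σ = 0 then Complex.I else -Complex.I) ^ u.2.val else 0) else if σ = τ then 0 else if σ = 0 then -(-Complex.I) ^ u.2.val else Complex.I ^ u.2.val; ∀ k : GaugedHubbard.Bond L → Fin 2 × ZMod 4, (∀ x : FermionTorus 2 L, m (m (m (k (x, 0)) (k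 (x.shift 0, 1))) (iv (k (x.shift 1, 0)))) (iv (k (x, 1))) = ((0 : Fin 2), (0 : ZMod 4))) → (let hopF := ∑ b : GaugedHubbard.Bond L, ∑ σ : Fin 2, ∑ τ : Fin 2, r (k b) σ τ • (creation (orb b.1 σ) * annihilation (orb (b.1.shift b.2) τ)); let A := -(hopF + hopFᴴ) + ((U : ℝ) : ℂ) • ∑ x : FermionTorus 2 L, numberOp x 0 * numberOp x 1; ∀ φ : Fock (Orb (FermionTorus 2 L)), φ ∈ (nParticleSubmodule (2 * ⌊(1 - δ) * (L : ℝ) ^ 2 / 2⌋₊) : Submodule ℂ (Fock (Orb (FermionTorus 2 L)))) → ((hubbardTorus 2 L 1 U).minEnergyOn (nParticleSubmodule (2 * ⌊(1 - δ) * (L : ℝ) ^ 2 / 2⌋₊) : Submodule ℂ (Fock (Orb (FermionTorus 2 L)))) - (ε)) * (star φ ⬝ᵥ φ).re ≤ (star φ ⬝ᵥ A *ᵥ φ).re)))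

/-- **Child 3 — `SgPenalisedEndpoint`** (support, provable now; text = the `statement` filed for the
route item). [folklore] -/
def SgPenalisedEndpoint : Prop :=
  open Literature.MathematicalPhysics.QuantumLattice in ∀ (U δ g₁ c₁ κ : ℝ) (L₂ L₃ : ℕ), 0 < U → δ ∈ Set.Ioo (0 : ℝ) (1 / 2) → 0 < g₁ → 0 < c₁ → 0 < κ → (∀ g : ℝ, 0 < g → g ≤ g₁ → ∀ (L : ℕ) [NeZero L], L₂ ≤ L → Even L → (let m : Fin 2 × ZMod 4 → Fin 2 × ZMod 4 → Fin 2 × ZMod 4 := fun u v => (u.1 + v.1, if u.1 = 0 then (if v.1 = 0 then u.2 + v.2 else v.2 - u.2) else if v.1 = 0 then u.2 + v.2 else 2 + v.2 - u.2); let iv : Fin 2 × ZMod 4 → Fin 2 × ZMod 4 := fun u => (u.1, if u.1 = 0 then -u.2 else u.2 + 2); let r : Fin 2 × ZMod 4 → Fin 2 → Fin 2 → ℂ := fun u σ τ => if u.1 = 0 then (if σ = τ then (if σ = 0 then Complex.I else -Complex.I) ^ u.2.val else 0) else if σ = τ then 0 else if σ = 0 then -(-Complex.I) ^ u.2.val else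 Complex.I ^ u.2.val; let hop := ∑ b : GaugedHubbard.Bond L, ∑ σ : Fin 2, ∑ τ : Fin 2, Matrix.kroneckerMap (· * ·) (creation (orb b.1 σ) * annihilation (orb (b.1.shift b.2) τ)) (Matrix.diagonal fun k : GaugedHubbard.Bond L → Fin 2 × ZMod 4 => r (k b) σ τ); let H := -(hop + hopᴴ) + ((U : ℝ) : ℂ) • Matrix.kroneckerMap (· * ·) (∑ x : FermionTorus 2 L, numberOp x 0 * numberOp x 1) (1 : Matrix (GaugedHubbard.Bond L → Fin 2 × ZMod 4) (GaugedHubbard.Bond L → Fin 2 × ZMod 4) ℂ) + ((g ^ 2 : ℝ) : ℂ) • Matrix.kroneckerMap (· * ·) (1 : Matrix (Finset (Orb (FermionTorus 2 L))) _ ℂ) (∑ b : GaugedHubbard.Bond L, Matrix.of fun k k' : GaugedHubbard.Bond L → Fin 2 × ZMod 4 => if k' = Function.update k b (k' b) then (if k b = k' b then (1 : ℂ) else 0) - 1 / 8 else 0) + ((1 / g ^ 2 : ℝ) : ℂ) • Matrix.kroneckerMap (· * ·) (1 : Matrix (Finset (Orb (FermionTorus 2 L))) _ ℂ) (Matrix.diagonal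 fun k : GaugedHubbard.Bond L → Fin 2 × ZMod 4 => ∑ x : FermionTorus 2 L, (1 - (r (m (m (m (k (x, 0)) (k (x.shift 0, 1))) (iv (k (x.shift 1, 0)))) (iv (k (x, 1)))) 0 0 + r (m (m (m (k (x, 0)) (k (x.shift 0, 1))) (iv (k (x.shift 1, 0)))) (iv (k (x, 1)))) 1 1) / 2)); let P := ∑ b : GaugedHubbard.Bond L, (if b.2 = 0 then (1 : ℂ) else -1) • ∑ σ : Fin 2, ∑ τ : Fin 2, Matrix.kroneckerMap (· * ·) (annihilation (orb b.1 σ) * annihilation (orb (b.1.shift b.2) τ)) (Matrix.diagonal fun k : GaugedHubbard.Bond L → Fin 2 × ZMod 4 => if σ = 0 then r (k b) 1 τ else -r (k b) 0 τ); let Hκ := H + ((κ / (L : ℝ) ^ 4 : ℝ) : ℂ) • (Pᴴ * P); let p := fun ik : Finset (Orb (FermionTorus 2 L)) × (GaugedHubbard.Bond L → Fin 2 × ZMod 4) => ik.1.card = 2 * ⌊(1 - δ) * (L : ℝ) ^ 2 / 2⌋₊; ∀ ψ : {ik // p ik} → ℂ, (ψ ≠ 0 ∧ ∃ E : ℝ,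 Hκ.toBlock p p *ᵥ ψ = (E : ℂ) • ψ ∧ ∀ φ : {ik // p ik} → ℂ, E * (star φ ⬝ᵥ φ).re ≤ (star φ ⬝ᵥ Hκ.toBlock p p *ᵥ φ).re) → c₁ * (L : ℝ) ^ 4 * (star ψ ⬝ᵥ ψ).re ≤ (star ψ ⬝ᵥ (Pᴴ * P).toBlock p p *ᵥ ψ).re)) → (∀ (L : ℕ) [NeZero L], L₃ ≤ L → Even L → (let m : Fin 2 × ZMod 4 → Fin 2 × ZMod 4 → Fin 2 × ZMod 4 := fun u v => (u.1 + v.1, if u.1 = 0 then (if v.1 = 0 then u.2 + v.2 else v.2 - u.2) else if v.1 = 0 then u.2 + v.2 else 2 + v.2 - u.2); let iv : Fin 2 × ZMod 4 → Fin 2 × ZMod 4 := fun u => (u.1, if u.1 = 0 then -u.2 else u.2 + 2); let r : Fin 2 × ZMod 4 → Fin 2 → Fin 2 → ℂ := fun u σ τ => if u.1 = 0 then (if σ = τ then (if σ = 0 then Complex.I else -Complex.I) ^ u.2.val else 0) else if σ = τ then 0 else if σ = 0 then -(-Complex.I) ^ u.2.val else Complex.I ^ u.2.val; ∀ k : GaugedHubbard.Bond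 L → Fin 2 × ZMod 4, (∀ x : FermionTorus 2 L, m (m (m (k (x, 0)) (k (x.shift 0, 1))) (iv (k (x.shift 1, 0)))) (iv (k (x, 1))) = ((0 : Fin 2), (0 : ZMod 4))) → (let hopF := ∑ b : GaugedHubbard.Bond L, ∑ σ : Fin 2, ∑ τ : Fin 2, r (k b) σ τ • (creation (orb b.1 σ) * annihilation (orb (b.1.shift b.2) τ)); let A := -(hopF + hopFᴴ) + ((U : ℝ) : ℂ) • ∑ x : FermionTorus 2 L, numberOp x 0 * numberOp x 1; ∀ φ : Fock (Orb (FermionTorus 2 L)), φ ∈ (nParticleSubmodule (2 * ⌊(1 - δ) * (L : ℝ) ^ 2 / 2⌋₊) : Submodule ℂ (Fock (Orb (FermionTorus 2 L)))) → ((hubbardTorus 2 L 1 U).minEnergyOn (nParticleSubmodule (2 * ⌊(1 - δ) * (L : ℝ) ^ 2 / 2⌋₊) : Submodule ℂ (Fock (Orb (FermionTorus 2 L)))) - (κ * c₁ / 2)) * (star φ ⬝ᵥ φ).re ≤ (star φ ⬝ᵥ A *ᵥ φ).re))) → ∃ a : ℝ, 0 < a ∧ ∃ L₄ : ℕ, (∀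 (L : ℕ) [NeZero L], L₄ ≤ L → Even L → ∀ ψ : Fock (Orb (FermionTorus 2 L)), star ψ ⬝ᵥ ψ = 1 → IsGroundStateInSector (hubbardTorus 2 L 1 U) (2 * ⌊(1 - δ) * (L : ℝ) ^ 2 / 2⌋₊) 0 ψ → a * (L : ℝ) ^ 4 ≤ (expect ((pairField dWaveFormFactor L)ᴴ * pairField dWaveFormFactor L) ψ).re)

/-! ### Parametrised vocabulary (definitionally the same texts) -/

/-- The corridor antecedent of `SgEndpoint` at `(U, δ, g₀, c', L₁)` — route text verbatim (cf. `Lines/birth.lean`). [folklore] -/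
def CorridorOrderAt (U δ g₀ c' : ℝ) (L₁ : ℕ) : Prop :=
  open Literature.MathematicalPhysics.QuantumLattice in ∀ g : ℝ, 0 < g → g ≤ g₀ → ∀ (L : ℕ) [NeZero L], L₁ ≤ L → Even L → (let m : Fin 2 × ZMod 4 → Fin 2 × ZMod 4 → Fin 2 × ZMod 4 := fun u v => (u.1 + v.1, if u.1 = 0 then (if v.1 = 0 then u.2 + v.2 else v.2 - u.2) else if v.1 = 0 then u.2 + v.2 else 2 + v.2 - u.2); let iv : Fin 2 × ZMod 4 → Fin 2 × ZMod 4 := fun u => (u.1, if u.1 = 0 then -u.2 else u.2 + 2); let r : Fin 2 × ZMod 4 → Fin 2 → Fin 2 → ℂ := fun u σ τ => if u.1 = 0 then (if σ = τ then (if σ = 0 then Complex.I else -Complex.I) ^ u.2.val else 0) else if σ = τ then 0 else if σ = 0 then -(-Complex.I) ^ u.2.val else Complex.I ^ u.2.val; let hop := ∑ b : GaugedHubbard.Bond L, ∑ σ : Fin 2, ∑ τ : Fin 2, Matrix.kroneckerMap (· * ·) (creation (orb b.1 σ) * annihilation (orb (b.1.shift b.2) τ)) (Matrix.diagonal fun k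 : GaugedHubbard.Bond L → Fin 2 × ZMod 4 => r (k b) σ τ); let H := -(hop + hopᴴ) + ((U : ℝ) : ℂ) • Matrix.kroneckerMap (· * ·) (∑ x : FermionTorus 2 L, numberOp x 0 * numberOp x 1) (1 : Matrix (GaugedHubbard.Bond L → Fin 2 × ZMod 4) (GaugedHubbard.Bond L → Fin 2 × ZMod 4) ℂ) + ((g ^ 2 : ℝ) : ℂ) • Matrix.kroneckerMap (· * ·) (1 : Matrix (Finset (Orb (FermionTorus 2 L))) _ ℂ) (∑ b : GaugedHubbard.Bond L, Matrix.of fun k k' : GaugedHubbard.Bond L → Fin 2 × ZMod 4 => if k' = Function.update k b (k' b) then (if k b = k' b then (1 : ℂ) else 0) - 1 / 8 else 0) + ((1 / g ^ 2 : ℝ) : ℂ) • Matrix.kroneckerMap (· * ·) (1 : Matrix (Finset (Orb (FermionTorus 2 L))) _ ℂ) (Matrix.diagonal fun k : GaugedHubbard.Bond L → Fin 2 × ZMod 4 => ∑ x : FermionTorus 2 L, (1 - (r (m (m (m (k (x, 0)) (k (x.shift 0, 1))) (iv (k (x.shift 1, 0)))) (iv (k (x, 1)))) 0 0 + r (m (m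 (m (k (x, 0)) (k (x.shift 0, 1))) (iv (k (x.shift 1, 0)))) (iv (k (x, 1)))) 1 1) / 2)); let P := ∑ b : GaugedHubbard.Bond L, (if b.2 = 0 then (1 : ℂ) else -1) • ∑ σ : Fin 2, ∑ τ : Fin 2, Matrix.kroneckerMap (· * ·) (annihilation (orb b.1 σ) * annihilation (orb (b.1.shift b.2) τ)) (Matrix.diagonal fun k : GaugedHubbard.Bond L → Fin 2 × ZMod 4 => if σ = 0 then r (k b) 1 τ else -r (k b) 0 τ); let p := fun ik : Finset (Orb (FermionTorus 2 L)) × (GaugedHubbard.Bond L → Fin 2 × ZMod 4) => ik.1.card = 2 * ⌊(1 - δ) * (L : ℝ) ^ 2 / 2⌋₊; ∀ ψ : {ik // p ik} → ℂ, (ψ ≠ 0 ∧ ∃ E : ℝ, H.toBlock p p *ᵥ ψ = (E : ℂ) • ψ ∧ ∀ φ : {ik // p ik} → ℂ, E * (star φ ⬝ᵥ φ).re ≤ (star φ ⬝ᵥ H.toBlock p p *ᵥ φ).re) → c' * (L : ℝ) ^ 4 * (star ψ ⬝ᵥ ψ).re ≤ (star ψ ⬝ᵥ (Pᴴ * P).toBlock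 p p *ᵥ ψ).re)

/-- PENALISED corridor order at `(U, δ, g₁, c₁, κ, L₂)`: the corridor text with `H` replaced, in the ground-state clause only, by `H + (κ/L⁴)·PᴴP` (a disfavouring gauge-invariant pair source of total norm `O(κ)`). [folklore] -/
def PenalisedCorridorAt (U δ g₁ c₁ κ : ℝ) (L₂ : ℕ) : Prop :=
  open Literature.MathematicalPhysics.QuantumLattice in ∀ g : ℝ, 0 < g → g ≤ g₁ → ∀ (L : ℕ) [NeZero L], L₂ ≤ L → Even L → (let m : Fin 2 × ZMod 4 → Fin 2 × ZMod 4 → Fin 2 × ZMod 4 := fun u v => (u.1 + v.1, if u.1 = 0 then (if v.1 = 0 then u.2 + v.2 else v.2 - u.2) else if v.1 = 0 then u.2 + v.2 else 2 + v.2 - u.2); let iv : Fin 2 × ZMod 4 → Fin 2 × ZMod 4 := fun u => (u.1, if u.1 = 0 then -u.2 else u.2 + 2); let r : Fin 2 × ZMod 4 → Fin 2 → Fin 2 → ℂ := fun u σ τ => if u.1 = 0 then (if σ = τ then (if σ = 0 then Complex.I else -Complex.I) ^ u.2.val else 0) else if σ = τ then 0 else if σ = 0 then -(-Complex.I) ^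 u.2.val else Complex.I ^ u.2.val; let hop := ∑ b : GaugedHubbard.Bond L, ∑ σ : Fin 2, ∑ τ : Fin 2, Matrix.kroneckerMap (· * ·) (creation (orb b.1 σ) * annihilation (orb (b.1.shift b.2) τ)) (Matrix.diagonal fun k : GaugedHubbard.Bond L → Fin 2 × ZMod 4 => r (k b) σ τ); let H := -(hop + hopᴴ) + ((U : ℝ) : ℂ) • Matrix.kroneckerMap (· * ·) (∑ x : FermionTorus 2 L, numberOp x 0 * numberOp x 1) (1 : Matrix (GaugedHubbard.Bond L → Fin 2 × ZMod 4) (GaugedHubbard.Bond L → Fin 2 × ZMod 4) ℂ) + ((g ^ 2 : ℝ) : ℂ) • Matrix.kroneckerMap (· * ·) (1 : Matrix (Finset (Orb (FermionTorus 2 L))) _ ℂ) (∑ b : GaugedHubbard.Bond L, Matrix.of fun k k' : GaugedHubbard.Bond L → Fin 2 × ZMod 4 => if k' = Function.update k b (k' b) then (if k b = k' b then (1 : ℂ) else 0) - 1 / 8 else 0) + ((1 / g ^ 2 : ℝ) : ℂ) • Matrix.kroneckerMap (· * ·) (1 : Matrix (Finset (Orb (FermionTorus 2 L))) _ ℂ)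 (Matrix.diagonal fun k : GaugedHubbard.Bond L → Fin 2 × ZMod 4 => ∑ x : FermionTorus 2 L, (1 - (r (m (m (m (k (x, 0)) (k (x.shift 0, 1))) (iv (k (x.shift 1, 0)))) (iv (k (x, 1)))) 0 0 + r (m (m (m (k (x, 0)) (k (x.shift 0, 1))) (iv (k (x.shift 1, 0)))) (iv (k (x, 1)))) 1 1) / 2)); let P := ∑ b : GaugedHubbard.Bond L, (if b.2 = 0 then (1 : ℂ) else -1) • ∑ σ : Fin 2, ∑ τ : Fin 2, Matrix.kroneckerMap (· * ·) (annihilation (orb b.1 σ) * annihilation (orb (b.1.shift b.2) τ)) (Matrix.diagonal fun k : GaugedHubbard.Bond L → Fin 2 × ZMod 4 => if σ = 0 then r (k b) 1 τ else -r (k b) 0 τ); let Hκ := H + ((κ / (L : ℝ) ^ 4 : ℝ) : ℂ) • (Pᴴ * P); let p := fun ik : Finset (Orb (FermionTorus 2 L)) × (GaugedHubbard.Bond L → Fin 2 × ZMod 4) => ik.1.card = 2 * ⌊(1 - δ) * (L : ℝ) ^ 2 / 2⌋₊; ∀ ψ : {ik // p ik} → ℂ, (ψ ≠ 0 ∧ ∃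 E : ℝ, Hκ.toBlock p p *ᵥ ψ = (E : ℂ) • ψ ∧ ∀ φ : {ik // p ik} → ℂ, E * (star φ ⬝ᵥ φ).re ≤ (star φ ⬝ᵥ Hκ.toBlock p p *ᵥ φ).re) → c₁ * (L : ℝ) ^ 4 * (star ψ ⬝ᵥ ψ).re ≤ (star ψ ⬝ᵥ (Pᴴ * P).toBlock p p *ᵥ ψ).re)

/-- Twist gap `≤ ε` from side `L₃` on: no FLAT `Q₈` configuration `k` has an `N_L`-particle frozen-link Rayleigh quotient more than `ε` below the `N_L`-block ground energy of the periodic torus. [folklore] -/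
def TwistGapSmallAt (U δ ε : ℝ) (L₃ : ℕ) : Prop :=
  open Literature.MathematicalPhysics.QuantumLattice in ∀ (L : ℕ) [NeZero L], L₃ ≤ L → Even L → (let m : Fin 2 × ZMod 4 → Fin 2 × ZMod 4 → Fin 2 × ZMod 4 := fun u v => (u.1 + v.1, if u.1 = 0 then (if v.1 = 0 then u.2 + v.2 else v.2 - u.2) else if v.1 = 0 then u.2 + v.2 else 2 + v.2 - u.2); let iv : Fin 2 × ZMod 4 → Fin 2 × ZMod 4 := fun u => (u.1, if u.1 = 0 then -u.2 else u.2 + 2); let r : Fin 2 × ZMod 4 → Fin 2 → Fin 2 → ℂ := fun u σ τ => if u.1 = 0 then (if σ = τ then (if σ = 0 then Complex.I else -Complex.I) ^ u.2.val else 0) else if σ = τ then 0 else if σ = 0 then -(-Complex.I) ^ u.2.val else Complex.I ^ u.2.val; ∀ k : GaugedHubbard.Bond L → Fin 2 × ZMod 4, (∀ x : FermionTorus 2 L, m (m (m (k (x, 0)) (k (x.shift 0, 1))) (iv (k (x.shift 1, 0)))) (iv (k (x, 1))) = ((0 : Fin 2), (0 : ZMod 4))) → (let hopF := ∑ b : GaugedHubbard.Bond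 L, ∑ σ : Fin 2, ∑ τ : Fin 2, r (k b) σ τ • (creation (orb b.1 σ) * annihilation (orb (b.1.shift b.2) τ)); let A := -(hopF + hopFᴴ) + ((U : ℝ) : ℂ) • ∑ x : FermionTorus 2 L, numberOp x 0 * numberOp x 1; ∀ φ : Fock (Orb (FermionTorus 2 L)), φ ∈ (nParticleSubmodule (2 * ⌊(1 - δ) * (L : ℝ) ^ 2 / 2⌋₊) : Submodule ℂ (Fock (Orb (FermionTorus 2 L)))) → ((hubbardTorus 2 L 1 U).minEnergyOn (nParticleSubmodule (2 * ⌊(1 - δ) * (L : ℝ) ^ 2 / 2⌋₊) : Submodule ℂ (Fock (Orb (FermionTorus 2 L)))) - (ε)) * (star φ ⬝ᵥ φ).re ≤ (star φ ⬝ᵥ A *ᵥ φ).re))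

/-- Every-ground-state `d`-wave order with constant `a` from side `L₄` on (finite-volume form of the summit's matrix at `(U,δ)`). [folklore] -/
def EveryGroundStateOrderAt (U δ a : ℝ) (L₄ : ℕ) : Prop :=
  open Literature.MathematicalPhysics.QuantumLattice in ∀ (L : ℕ) [NeZero L], L₄ ≤ L → Even L → ∀ ψ : Fock (Orb (FermionTorus 2 L)), star ψ ⬝ᵥ ψ = 1 → IsGroundStateInSector (hubbardTorus 2 L 1 U) (2 * ⌊(1 - δ) * (L : ℝ) ^ 2 / 2⌋₊) 0 ψ → a * (L : ℝ) ^ 4 ≤ (expect ((pairField dWaveFormFactor L)ᴴ * pairField dWaveFormFactor L) ψ).re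

/-- The consequent of `SgEndpoint` at `(U, δ)` — the summit's matrix verbatim. [folklore] -/
def SectorLROAt (U δ : ℝ) : Prop :=
  open Literature.MathematicalPhysics.QuantumLattice in ∀ (N : ℕ → ℕ) (ψ : ∀ L, Fock (Orb (FermionTorus 2 L))), (∀ L, Even L → N L = 2 * ⌊(1 - δ) * (L : ℝ) ^ 2 / 2⌋₊ ∧ star (ψ L) ⬝ᵥ ψ L = 1 ∧ IsGroundStateInSector (hubbardTorus 2 L 1 U) (N L) 0 (ψ L)) → Literature.Probability.LatticeModels.HasLongRangeOrder (fun k => Literature.Probability.LatticeModels.halfOpenBox 2 (2 * k)) (fun k => torusPullback (pairFieldCorr dWaveFormFactor ψ) (2 * k))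

/-- The crux BY NAME is "corridor antecedent → summit matrix", pointwise in `(U, δ)`. [folklore] -/
theorem sgEndpoint_iff :
    Summit.HubbardSuperconductivity.HubbardSuperconductivity.Theses.ColourTheSpin.SgEndpoint ↔
      ∀ (U δ g₀ c' : ℝ) (L₁ : ℕ), 0 < U → δ ∈ Set.Ioo (0 : ℝ) (1 / 2) → 0 < g₀ → 0 < c' →
        CorridorOrderAt U δ g₀ c' L₁ → SectorLROAt U δ :=
  Iff.rfl

/-- Child 1 in vocabulary form. [folklore] -/
theorem sgPenaltyUpgrade_iff :
    SgPenaltyUpgrade ↔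
      ∀ (U δ g₀ c' : ℝ) (L₁ : ℕ), 0 < U → δ ∈ Set.Ioo (0 : ℝ) (1 / 2) → 0 < g₀ → 0 < c' →
        CorridorOrderAt U δ g₀ c' L₁ →
          ∃ g₁ : ℝ, 0 < g₁ ∧ ∃ c₁ : ℝ, 0 < c₁ ∧ ∃ κ : ℝ, 0 < κ ∧ ∃ L₂ : ℕ,
            PenalisedCorridorAt U δ g₁ c₁ κ L₂ :=
  Iff.rfl

/-- Child 2 in vocabulary form. [folklore] -/
theorem sgTwistGap_iff :
    SgTwistGap ↔
      ∀ (U δ g₀ c' : ℝ) (L₁ : ℕ), 0 < U → δ ∈ Set.Ioo (0 : ℝ) (1 / 2) → 0 < g₀ → 0 < c' →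
        CorridorOrderAt U δ g₀ c' L₁ → ∀ ε : ℝ, 0 < ε → ∃ L₃ : ℕ, TwistGapSmallAt U δ ε L₃ :=
  Iff.rfl

/-- Child 3 in vocabulary form. [folklore] -/
theorem sgPenalisedEndpoint_iff :
    SgPenalisedEndpoint ↔
      ∀ (U δ g₁ c₁ κ : ℝ) (L₂ L₃ : ℕ), 0 < U → δ ∈ Set.Ioo (0 : ℝ) (1 / 2) → 0 < g₁ → 0 < c₁ → 0 < κ →
        PenalisedCorridorAt U δ g₁ c₁ κ L₂ → TwistGapSmallAt U δ (κ * c₁ / 2) L₃ →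
          ∃ a : ℝ, 0 < a ∧ ∃ L₄ : ℕ, EveryGroundStateOrderAt U δ a L₄ :=
  Iff.rfl

end Verbatim

open Matrix Finset Filter
open Literature.Probability.LatticeModels Literature.MathematicalPhysics.QuantumLattice

/-- Finite-volume order `a·L⁴ ≤ Re⟨ψ_L, Δ†Δ ψ_L⟩` of EVERY sector ground state at all large even `L`
gives the summit's conclusion at `(U, δ)` — the landed bookkeeping `hasLongRangeOrder_even_of_le` with
the sum rule `sum_pairFieldCorr_succ`. [folklore] -/
theorem sectorLROAt_of_everyGroundStateOrderAt {U δ a : ℝ} {L₄ : ℕ} (ha : 0 < a)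
    (h : EveryGroundStateOrderAt U δ a L₄) : SectorLROAt U δ := by
  intro N ψ hadm
  refine hasLongRangeOrder_even_of_le dWaveFormFactor ψ (fun n hn => (hadm (n + 1) hn).2.1) ha L₄
    (fun n hn hK => ?_)
  rw [sum_pairFieldCorr_succ dWaveFormFactor ψ n]
  obtain ⟨hNn, hnorm, hgs⟩ := hadm (n + 1) hn
  rw [hNn] at hgs
  exact h (n + 1) hK hn (ψ (n + 1)) hnorm hgs

/-- **SPLIT GLUE (the strategist's `SgEndpoint_of_subs`).**
`SgPenaltyUpgrade → SgTwistGap → SgPenalisedEndpoint → Theses.ColourTheSpin.SgEndpoint`: at `(U,δ)`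
child 1 turns the corridor antecedent into penalised corridor order with some `(g₁, c₁, κ, L₂)`, child 2
supplies the twist gap `≤ κc₁/2` from some `L₃` on, child 3 gives every-ground-state finite-volume
order, and `sectorLROAt_of_everyGroundStateOrderAt` the summit's matrix. Sorry-free; conditional on
the three children (none is proved here). [folklore] -/
theorem sgEndpoint_of_subs :
    SgPenaltyUpgrade → SgTwistGap → SgPenalisedEndpoint →
      Summit.HubbardSuperconductivity.HubbardSuperconductivity.Theses.ColourTheSpin.SgEndpoint := by
  intro h1 h3 h2
  refine sgEndpoint_iff.2 fun U δ g₀ c' L₁ hU hδ hg hc hC => ?_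
  obtain ⟨g₁, hg₁, c₁, hc₁, κ, hκ, L₂, hP⟩ := sgPenaltyUpgrade_iff.1 h1 U δ g₀ c' L₁ hU hδ hg hc hC
  obtain ⟨L₃, hT⟩ := sgTwistGap_iff.1 h3 U δ g₀ c' L₁ hU hδ hg hc hC (κ * c₁ / 2) (by positivity)
  obtain ⟨a, ha, L₄, hE⟩ := sgPenalisedEndpoint_iff.1 h2 U δ g₁ c₁ κ L₂ L₃ hU hδ hg₁ hc₁ hκ hP hT
  exact sectorLROAt_of_everyGroundStateOrderAt ha hE

end Summit.HubbardSuperconductivity.HubbardSuperconductivity.Theorems.ColourTheSpin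

end
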